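import Summits.BirchSwinnertonDyer.Rank1Residual.GaloisImage.KolyvaginSystemOfEulerSystemTransverse
import Summits.BirchSwinnertonDyer.Rank1Residual.GaloisImage.KolyvaginDerivativeFamily
import Summits.BirchSwinnertonDyer.Rank1Residual.GaloisImage.CyclotomicLevelInertiaGeneratorsAbsNorm
import Summits.BirchSwinnertonDyer.Rank1Residual.GaloisImage.AbelianExtensionTorsion
import HarnessLib

/-!
# THEOREM D (END, row class "vacuous conditions at the bad places and at `p`"): an Euler system of
# `T_p E / ℚ` yields a Kolyvagin system for `(E[m], 𝓕, 𝒫)` — existence of the family, all clauses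
# discharged except the one displayed hypothesis `𝓕_w = ⊤` at the bad `w` and at `p`
# (cell `b2b-bsdres`, n1011 p11 GEN 10; row T-DER, THEOREM D file D5a)

HONEST FRAMING (cell `b2b-bsdres`, run/shared/lean/b2b/bsd-rank1-residual/, verbatim in every
file): the goal of the cell is to DELETE the COMBINATION-SHAPED residual classes of the
Birch–Swinnerton-Dyer formula for ALL analytic-rank `≤ 1` elliptic curves over `ℚ` — "full BSD
formula for every rank `≤ 1` curve in class `C`" assembled STRICTLY from published theorems — so
that the rank-`≤ 1` remainder becomes exactly the CONSTRUCTION-SHAPED classes, which are TYPED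
(missing-input `Prop`s), NOT attempted. This is not "finishing BSD". Team n1011: research route on
the CONSTRUCTION-SHAPED class X4 / §I N11 (route-1 PORT, (P-DER), clause C1/C0); TOOL theorem.
HONEST LIMITS: NO Euler system is asserted to exist (it is the hypothesis `hc`; the PORT binds it to
Kato's `ZetaBody … |>.1` by the §48.4 socket); the PORT's clause C1 ("unitriangular modification")
is met with `κ′ = κ`; the value clauses C2/C3 (dual exponential, Kurihara numbers) are NOT here; the
local conditions at the bad places and at `p` are NOT proved here — they are the displayed
hypothesis `htop` (vacuous conditions), discharged per row class elsewhere (F10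
`LocalH1VanishingOfNoTorsion` at bad `w ∤ p` with `E(ℚ_w)[p] = 0`; F11/F12
`PropagatedConditionTopOfNoTorsion[Three]` at `p = 3` with `E(ℚ₃)[3] = 0`).  No definition, no
named fact, no `sorry`.

## What

**`exists_isKolyvaginSystem_of_eulerSystem`.**  Data: `E/ℚ` globally minimal, `p ≠ 2` with `E[p]`
irreducible (`hirr` — gives `E[m]^{Gal(ℚ̄/ℚ(μ_r))} = 0` at every level, p11 T-R18a
`geomPoints_eq_zero_of_fixed_of_pow_smul_eq_zero`), an Euler system `c` of `T_pE` over
`cyclotomicLevelsRat p S` (`hc`), a `ℤ_p`-linear quotient `red : T_pE ⟶ T′` onto, killed by `p^n`,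
read in `E[m]` (`m = p^n`) through an additive continuous equivariant bijection `e` (instance-free;
the `torsionRepPadicInt` reading: `e` = the identity), a Kolyvagin datum `D` on `E[m]` with the
cyclotomic transverse conditions (`hT`) and THE canonical comparison maps for primitive roots `η`
(`hD`), `𝒫 ⊆` Kolyvagin primes of level `n` off `S ∪ {p}` (`hPr`, `hKol`), and a Selmer structure
`𝓕` containing the unramified classes at every good `w ≠ p` (`hunr`) and EQUAL TO `⊤` at the bad
places and at `p` (`htop`).  Conclusion: there are generators `σ` (in the inertia groups
`I_{𝔓₀(ℓ)}`, `χ_{Nℓ}(σ_ℓ) = η_ℓ`: D1), transports `Φ_r` computed on cocycles by `e` (GZ-1), and ONE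
family `κ : Finset → H¹(ℚ, E[m])` (D2) with **`D.IsKolyvaginSystem 𝓕 κ`** (D3/D3b: support,
Selmer membership, `fs_rel`), `κ r = 0` off the levels, and at every level
`res_{U_r} (κ r) = D_r (Φ_r (red_* c_{0,r}))` — Kolyvagin's derivative class of `c`.
References: B. Mazur, K. Rubin, Mem. AMS 799 (2004), Thm. 3.2.4, App. A; K. Rubin, *Euler Systems*
(2000), §4.4–4.5; R. Sakamoto, JTNB 36 (2024), Def. 4.1; C.-H. Kim, arXiv:2203.12159, §2.2.2.
-/

noncomputable section

open CategoryTheory Function Finset Polynomial Field IsDedekindDomain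
open scoped NumberField
open Literature.NumberTheory.GaloisRepresentations Literature.NumberTheory.EllipticCurves
open Literature.NumberTheory.GaloisRepresentations.DiscreteGaloisModule
open Literature.NumberTheory.GaloisCohomology
open Summit.BirchSwinnertonDyer.Rank1Residual.GaloisImage.CoeffTransport
open Summit.BirchSwinnertonDyer.Rank1Residual.GaloisImage.CyclotomicLevel
open Rat.HeightOneSpectrum

universe u

namespace Summit.BirchSwinnertonDyer.Rank1Residual.GaloisImage.Derivative.Rat

variable (W : WeierstrassCurve ℚ) [W.IsElliptic] [W.IsGloballyMinimal] (p : ℕ) [Fact p.Prime]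
variable [Module.Free ℤ_[p] (W.tateModule p)] [Module.Finite ℤ_[p] (W.tateModule p)]
  [ContinuousSMul ℤ_[p] (W.tateModule p)]

/-- Local notation: `T∞ = T_p E` as a continuous `G_ℚ`-representation. -/
local notation3 "T∞" => WeierstrassCurve.tateGaloisRep W p (W.continuous_galoisRepTate_holds p)

/-- Local notation: `𝐫⟦f, T′, U⟧ = f_* : H¹(U, T_pE) → H¹(U, T′)`. -/
local notation3 (prettyPrint := false) "𝐫⟦" f ", " Tg ", " U "⟧" =>
  ContinuousCohomology.map (ContinuousMonoidHom.id _)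
    (X := subgroupRep (ContinuousRep.toTopRep T∞) U)
    (Y := subgroupRep (ContinuousRep.toTopRep Tg) U)
    ((TopRep.resFunctor (Subgroup.subtype U)).map f) 1

variable (S : Set (HeightOneSpectrum (𝓞 ℚ)))

/-- Local notation: `𝓛` = the cyclotomic Euler-system levels `ℚ(μ_{p^{n+1}}, μ_r)`, `r ∩ S = ∅`. -/
local notation3 "𝓛" => cyclotomicLevelsRat p S

/-- Local notation: `𝐃⟦A, X, U, τ⟧ ℓ = ∑_{j < ℓ−1} j·(τ_ℓ)_*^j`, Kolyvagin's derivative operator of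
the place `ℓ` on `H¹(U, X)` (`A`-linear) for the generator `τ_ℓ`. -/
local notation3 (prettyPrint := false) "𝐃⟦" A ", " X ", " U ", " τ "⟧" =>
  fun ℓ : HeightOneSpectrum (𝓞 ℚ) =>
  ∑ j ∈ Finset.range (((primesEquiv ℓ : Nat.Primes) : ℕ) - 1),
    (j : Module.End A (continuousCohomology 1 (subgroupRep X U))) *
      (conjMap X U ((τ : HeightOneSpectrum (𝓞 ℚ) → absoluteGaloisGroup ℚ) ℓ) 1).hom.toLinearMap ^ j

omit [W.IsGloballyMinimal] [Module.Free ℤ_[p] (W.tateModule p)] [Module.Finite ℤ_[p] (W.tateModule p)]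
  [ContinuousSMul ℤ_[p] (W.tateModule p)] in
/-- **`E[p^n]^{Gal(ℚ̄/ℚ(μ_r, μ_{p^i}))} = 0` under `Irr(E[p])`, `p` odd** — THEOREM A3's binder `h0`
at every level (the levels contain the commutator subgroup; p11 T-R18a
`geomPoints_eq_zero_of_fixed_of_pow_smul_eq_zero`). [cite: Serre1972, §5.2 (iv) and §5.4] -/
theorem geomTorsion_eq_zero_of_fixed_level (hp2 : p ≠ 2) (hirr : W.HasIrreducibleModPGaloisRep p)
    {n : ℕ} {m : ℤ} (hm : m = ((p ^ n : ℕ) : ℤ)) (i : ℕ) (r : Finset (HeightOneSpectrum (𝓞 ℚ)))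
    (P : WeierstrassCurve.geomTorsion W m)
    (hP : ∀ u : (𝓛).level i r, (u : absoluteGaloisGroup ℚ) • P = P) : P = 0 := by
  apply Subtype.ext
  refine geomPoints_eq_zero_of_fixed_of_pow_smul_eq_zero W p hp2 hirr ((𝓛).commutator_le_level i r)
    (P : WeierstrassCurve.geomPoints W) (fun σ hσ => ?_) n ?_
  · have h := congrArg Subtype.val (hP ⟨σ, hσ⟩)
    exact h
  · subst hm
    have h := (WeierstrassCurve.mem_geomTorsion_iff W _ _).mp P.2
    rwa [natCast_zsmul] at h

/-- **THEOREM D (END for the row class "vacuous conditions at the bad places and at `p`")** — see the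
module docstring for every binder and the HONEST LIMITS.
[cite: MazurRubin2004, Thm. 3.2.4 and App. A] [cite: Rubin2000, Def. 4.4.10, Thm. 4.5.1, Thm. 4.5.4]
[cite: Sakamoto2024, Def. 4.1 (p. 926)] [cite: Kim2022StructureSelmer, §2.2.2] -/
theorem exists_isKolyvaginSystem_of_eulerSystem (hp2 : p ≠ 2)
    {c : ∀ (i : ℕ) (r : (𝓛).Ideals), H1 T∞ ((𝓛).level i r.1)}
    (hc : IsEulerSystem 𝓛 T∞ p c)
    {M' : Type} [AddCommGroup M'] [Module ℤ_[p] M'] [TopologicalSpace M'] [DiscreteTopology M']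
    [IsTopologicalAddGroup M'] [ContinuousSMul ℤ_[p] M'] {T' : GaloisRep ℚ ℤ_[p] M'}
    (red : T∞.toTopRep ⟶ T'.toTopRep) (hred : Function.Surjective red.hom)
    {n : ℕ} (hn : 0 < n) (hM : ∀ m : M', ((p : ℤ_[p]) ^ n) • m = 0)
    {m : ℤ} (hm : m = ((p ^ n : ℕ) : ℤ))
    [Module (ZMod (p ^ n)) (WeierstrassCurve.geomTorsion W m)]
    [Module.Free (ZMod (p ^ n)) (WeierstrassCurve.geomTorsion W m)]
    [Module.Finite (ZMod (p ^ n)) (WeierstrassCurve.geomTorsion W m)]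
    (e : M' →+ WeierstrassCurve.geomTorsion W m) (hec : Continuous e)
    (he : ∀ (g : absoluteGaloisGroup ℚ) (x : M'),
      e (T'.toTopRep.ρ g x) = (W.torsionGaloisModule m).toTopRep.ρ g (e x))
    (einv : WeierstrassCurve.geomTorsion W m →+ M') (hic : Continuous einv)
    (h₁ : ∀ x, einv (e x) = x) (h₂ : ∀ y, e (einv y) = y)
    (hirr : W.HasIrreducibleModPGaloisRep p)
    (D : KolyvaginDatum (W.torsionGaloisModule m))
    (hT : D.transverse = cyclotomicTransverse (W.torsionGaloisModule m))
    {η : (ℓ : HeightOneSpectrum (𝓞 ℚ)) → (ZMod (Ideal.absNorm ℓ.asIdeal))ˣ}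
    (hD : D.HasCanonicalComparison (p ^ n) η)
    (hPr : D.primes ⊆ (𝓛).primes)
    (hKol : ∀ ℓ ∈ D.primes, Kato.IsKolyvaginPrime W p n ((primesEquiv ℓ : Nat.Primes) : ℕ))
    (𝓕 : SelmerStructure (W.torsionGaloisModule m))
    (hunr : ∀ w : HeightOneSpectrum (𝓞 ℚ), W.HasGoodReductionAt w →
      ((primesEquiv w : Nat.Primes) : ℕ) ≠ p →
        unramifiedSubgroup (GaloisRep.toLocal w (W.torsionGaloisModule m)) 1 ≤ 𝓕 (Sum.inr w))
    (htop : ∀ w : HeightOneSpectrum (𝓞 ℚ),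
      ¬ (W.HasGoodReductionAt w ∧ ((primesEquiv w : Nat.Primes) : ℕ) ≠ p) → 𝓕 (Sum.inr w) = ⊤) :
    ∃ (σ : HeightOneSpectrum (𝓞 ℚ) → absoluteGaloisGroup ℚ)
      (Φ : ∀ r : Finset (HeightOneSpectrum (𝓞 ℚ)),
        continuousCohomology 1 (subgroupRep T'.toTopRep ((𝓛).level ⊥ r)) →+
          continuousCohomology 1 (subgroupRep (W.torsionGaloisModule m).toTopRep ((𝓛).level ⊥ r)))
      (comm : ∀ r : Finset (HeightOneSpectrum (𝓞 ℚ)),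
        ((r : Finset _) : Set (HeightOneSpectrum (𝓞 ℚ))).Pairwise fun a b =>
          Commute (𝐃⟦ℤ, (W.torsionGaloisModule m).toTopRep, ((𝓛).level ⊥ r), σ⟧ a)
            (𝐃⟦ℤ, (W.torsionGaloisModule m).toTopRep, ((𝓛).level ⊥ r), σ⟧ b))
      (κ : Finset (HeightOneSpectrum (𝓞 ℚ)) → galoisCohomology (W.torsionGaloisModule m) 1),
      (∀ ℓ, σ ℓ ∈ (adicCompletionPrime ℚ ℓ).inertia (absoluteGaloisGroup ℚ)) ∧
      (∀ ℓ, modNCyclotomicCharacter ℚ (Ideal.absNorm ℓ.asIdeal) (σ ℓ) = η ℓ) ∧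
      (∀ r, ∀ (φ : contOneCocycles (subgroupRep T'.toTopRep ((𝓛).level ⊥ r)))
        (ψ : contOneCocycles (subgroupRep (W.torsionGaloisModule m).toTopRep ((𝓛).level ⊥ r))),
        (∀ g, ψ.1 g = e (φ.1 g)) → Φ r (oneCocycleClass _ φ) = oneCocycleClass _ ψ) ∧
      D.IsKolyvaginSystem 𝓕 κ ∧
      (∀ r : Finset (HeightOneSpectrum (𝓞 ℚ)), ¬ (↑r : Set _) ⊆ D.primes → κ r = 0) ∧
      ∀ (r : Finset (HeightOneSpectrum (𝓞 ℚ))) (hr : (↑r : Set _) ⊆ D.primes),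
        resSubgroup (W.torsionGaloisModule m).toTopRep ((𝓛).level ⊥ r) 1 (κ r) =
          (r.noncommProd 𝐃⟦ℤ, (W.torsionGaloisModule m).toTopRep, ((𝓛).level ⊥ r), σ⟧ (comm r))
            (Φ r (𝐫⟦red, T', ((𝓛).level ⊥ r)⟧
              (c ⊥ ⟨r, fun _ hq => hPr (hr (Finset.mem_coe.2 hq))⟩))) := by
  -- the generators (D1)
  obtain ⟨σ, hσI, hσχ, -, hσ⟩ := CyclotomicLevel.Rat.exists_sigma_mem_inertia_adicCompletionPrime p S η
    D.primes (fun ℓ hℓ => hD.zpowers_eq_top hℓ)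
  -- `h0` at every level from `Irr(E[p])`
  have h0 : ∀ r : Finset (HeightOneSpectrum (𝓞 ℚ)), (↑r : Set _) ⊆ D.primes →
      ∀ P : WeierstrassCurve.geomTorsion W m,
        (∀ u : (𝓛).level ⊥ r, (u : absoluteGaloisGroup ℚ) • P = P) → P = 0 :=
    fun r _ P hP => geomTorsion_eq_zero_of_fixed_level W p S hp2 hirr hm ⊥ r P hP
  -- the family (D2)
  obtain ⟨Φ, comm, hΦ, κ, hκ0, hκ⟩ := exists_derivativeFamily W p S hc red hn hM e hec he einv hic h₁ h₂
    D.primes hPr hKol σ hσ h0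
  refine ⟨σ, Φ, comm, κ, hσI, hσχ, hΦ, ?_, hκ0, fun r hr => (hκ r hr).1⟩
  -- THEOREM D-core with the transverse clause discharged (D3b), the bad places and `p` by `htop`
  exact isKolyvaginSystem_derivativeFamily_of_transverse_eq W p S hp2 hc red hred hn hM hm e hec he
    einv hic h₁ h₂ D hT hD hPr hKol σ (fun ℓ _ => hσI ℓ) (fun ℓ _ => hσχ ℓ) hσ h0 Φ hΦ comm κ hκ0
    (fun r hr => (hκ r hr).1) 𝓕 hunr fun r _ w _ hw => by rw [htop w hw]; exact AddSubgroup.mem_top _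

end Summit.BirchSwinnertonDyer.Rank1Residual.GaloisImage.Derivative.Rat

end
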